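import Mathlib
import Summits.NavierStokesRegularity.NavierStokesRegularity.Theorems.WakeRatchetTailRatchetRelayFront
import Summits.NavierStokesRegularity.NavierStokesRegularity.Theorems.WakeRatchetTailRatchetRelayLinearResponse
import Summits.NavierStokesRegularity.NavierStokesRegularity.Theorems.WakeRatchetTailRatchet.Negative.TailRatchetFalseOfDyadicScalarFronts
import Literature.Analysis.FluidPDE.Tao2016AveragedNS.BoundedEternalSolutions
import HarnessLib

/-!
# `WakeRatchet.TailRatchet` (stmt-NavierStokesRegularity-21808): EXACT LACUNARY DYADIC DSS FRONTS —
# an existence theorem for the scalar front equation of `DyadicScalarFronts` at ONE (large) scale ratio,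
# and the first NON-ZERO uniformly bounded admissible eternal solution of an E₂(2) table

Support file for the crux `TailRatchet` (route `WakeRatchet`; MODEL lattice ODEs of Tao 2016 §1.2, §4 —
nothing in this file is a statement about the Navier–Stokes equations, and no item is closed here).

Context (programme "R-lac" of the census of stmt-21808, CONCLUSION).  `…RelayFront.relay_front_exists` gives,
for every time ratio `s ∈ [2 − 10⁻²⁶, 2]`, an exact solution `b = e^{t} + h` of
`b' = (4/s²)b(t/s)² − 4sδ_s b(t)b(st)` with `|δ_s − ε₁(s)| ≤ 10²²(2−s)²`, and
`…RelayLinearResponse.linear_response_lower` gives `ε₁(s) ≥ (2−s)/11360`; so `δ_s > 0` for `s < 2` close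
to `2`, `Λ := δ_s^{-1/2}` is a genuine lattice ratio, and `a := (4/Λ)b` solves the SCALAR FRONT EQUATION OF
THE INVISCID DYADIC CHAIN `a'(t) = (Λ/s²)a(t/s)² − (s/Λ)a(t)a(st)` (`t < 0`) with `Λ = bigLam ε₀`,
`ε₀ = Λ^{2/5} − 1 > 0`, integrable on `(−∞,0)`, bounded near `0⁻`, non-zero:

* `lacunary_scalar_front` — the four clauses of `WakeRatchetDyadicFront.DyadicScalarFronts` hold at SOME
  `ε₀ > 0` (a LARGE one: `Λ ≳ 10⁹`), for every `s ∈ [2 − η₀, 2)`;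
* `lacunary_dssWave` — hence (tree dictionary `isDSSWave_dyadic_of_scalarFront`) a NON-TRIVIAL admissible
  single-profile DSS blow-up wave of the dyadic member `dyadicTable ∈ E₂(2)` exists at some `ε₀ > 0`;
* `nontrivial_bounded_eternal` — hence a NON-ZERO uniformly bounded admissible eternal solution of
  `dyadicTable` exists at some `ε₀ > 0`: the hypothesis class of the K1-family statements (`TailRatchet`,
  `TailRateRatchet`, `EternalInviscidRate`, …; so far only `W = 0` was exhibited, cf. the docstring of
  `Literature.…BoundedEternalSolutions`) is NON-EMPTY.

WHAT THIS IS NOT: `DyadicScalarFronts` asks for such fronts along `ε₀ → 0` (`Λ → 1⁺`); the fronts here live at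
the opposite, LACUNARY end `Λ → ∞` (`s → 2⁻`), where the drain is perturbative around the relay profile
`(4/Λ)e^{t}`.  They do NOT refute `TailRatchet`; the continuation `Λ → 1⁺` (programme R-cont) is open and not
in print.  First existence theorem for an exact discretely self-similar blow-up front of the
Katz–Pavlović/Desnyansky–Novikov dyadic chain known to the tree (presearch of the census: Dombre–Gilson 1998,
Mailybaev 2012/2013 assume/numerically observe the wave; Barbato–Flandoli–Morandin 2011 and Jeong 2017 treat
the separable `a_n/(t₀−t)` solutions, which are not fronts).

HONEST FRAMING: MODEL lattice only; the construction item `DyadicScalarFronts` and the crux stay open.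
-/

noncomputable section

set_option linter.dupNamespace false

namespace Summit.NavierStokesRegularity.NavierStokesRegularity.Theorems

namespace WakeRatchetLacunaryFront

open Set Filter Topology MeasureTheory
open Literature.Analysis.FluidPDE Literature.Analysis.FluidPDE.TaoCascade
open WakeRatchetRelayFront WakeRatchetRelayLinearResponse WakeRatchetDyadicFront

/-- **EXACT LACUNARY SCALAR DYADIC FRONTS.**  There is `η₀ > 0` such that for every time ratio
`s ∈ [2 − η₀, 2)` there are a scale parameter `ε₀ > 0` and a real function `a` on `t < 0` — non-zero,
integrable on `(−∞,0)`, bounded near `0⁻` — solving the scalar front equation of the inviscid dyadic chain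
`a'(t) = (Λ/s²) a(t/s)² − (s/Λ) a(t) a(st)`, `Λ = bigLam ε₀ = (1+ε₀)^{5/2}`: the four clauses of
`WakeRatchetDyadicFront.DyadicScalarFronts` at ONE (large) `ε₀`.  Explicitly `a = 4δ_s^{1/2}(e^{t} + h)`,
`Λ = δ_s^{-1/2}`, with `(h, δ_s)` the lacunary front of `…RelayFront.relay_front_exists`.
[cite: Tao2016AveragedNS, §1.2 (dyadic Katz–Pavlović model); cell vocabulary (`DyadicScalarFronts`, `bigLam`; programme R-lac of the census of stmt-21808)] -/
theorem lacunary_scalar_front :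
    ∃ η₀ : ℝ, 0 < η₀ ∧ ∀ s : ℝ, 2 - η₀ ≤ s → s < 2 →
      ∃ ε₀ : ℝ, 0 < ε₀ ∧ ∃ a : ℝ → ℝ,
        (∀ t : ℝ, t < 0 → HasDerivAt a
          (bigLam ε₀ / s ^ 2 * a (t / s) ^ 2 - s / bigLam ε₀ * a t * a (s * t)) t) ∧
        IntegrableOn a (Iio 0) ∧
        (∃ t₀ : ℝ, t₀ < 0 ∧ ∃ P : ℝ, ∀ t : ℝ, t₀ ≤ t → t < 0 → |a t| ≤ P) ∧
        ∃ t : ℝ, t < 0 ∧ a t ≠ 0 := by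
  obtain ⟨η₁, hη₁, hresp⟩ := linear_response_lower
  refine ⟨min η₁ (1 / (2 * 10 ^ 26)), lt_min hη₁ (by norm_num), fun s hsl hsu => ?_⟩
  have hm1 := min_le_left η₁ (1 / (2 * 10 ^ 26) : ℝ)
  have hm2 := min_le_right η₁ (1 / (2 * 10 ^ 26) : ℝ)
  set η : ℝ := 2 - s with hη
  have hηpos : 0 < η := by rw [hη]; linarith
  have hη1 : η ≤ 1 / (2 * 10 ^ 26) := by rw [hη]; linarith
  have hs1 : 2 - 1 / 10 ^ 26 ≤ s := by
    have : (1 : ℝ) / (2 * 10 ^ 26) ≤ 1 / 10 ^ 26 := by norm_num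
    linarith
  have hs0 : 0 < s := by
    have : (1 : ℝ) / (2 * 10 ^ 26) ≤ 1 := by norm_num
    linarith
  -- the lacunary front and the sign of its drain parameter
  obtain ⟨δ, h, hcont, hh0, hhρ, hδle, hfront, hsecond⟩ := relay_front_exists hs1 hsu.le
  have hε₁ := hresp s (by linarith) hsu.le
  have hδpos : 0 < δ := by
    have h1 := (abs_le.1 hsecond).1
    rw [← hη] at h1 hε₁
    -- `δ ≥ η/11360 − 10²²η² > 0`
    have h2 : (10 : ℝ) ^ 22 * η ^ 2 ≤ η / 20000 := by
      rw [show (10 : ℝ) ^ 22 * η ^ 2 = (10 ^ 22 * η) * η by ring, div_eq_mul_inv, mul_comm η]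
      exact mul_le_mul_of_nonneg_right (by nlinarith) hηpos.le
    nlinarith
  have hδlt : δ < 1 := by
    have : (8800000 : ℝ) * (2 - s) < 1 := by rw [← hη]; nlinarith
    linarith [(abs_le.1 hδle).2]
  -- `μ = δ^{1/2}`, `Λ = 1/μ`, `ε₀ = Λ^{2/5} − 1`
  set μ : ℝ := Real.sqrt δ with hμ
  have hμpos : 0 < μ := Real.sqrt_pos.2 hδpos
  have hμsq : μ ^ 2 = δ := Real.sq_sqrt hδpos.le
  have hμlt : μ < 1 := by
    rw [hμ]
    calc Real.sqrt δ < Real.sqrt 1 := Real.sqrt_lt_sqrt hδpos.le hδlt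
      _ = 1 := Real.sqrt_one
  set ε₀ : ℝ := (1 / μ) ^ ((2 : ℝ) / 5) - 1 with hε₀
  have hinv : 1 < 1 / μ := by rw [lt_div_iff₀ hμpos]; linarith
  have hε₀pos : 0 < ε₀ := by
    rw [hε₀, sub_pos]
    exact Real.one_lt_rpow hinv (by norm_num)
  have hΛ : bigLam ε₀ = 1 / μ := by
    unfold bigLam
    rw [hε₀, add_sub_cancel, ← Real.rpow_mul (by positivity)]
    norm_num
  refine ⟨ε₀, hε₀pos, fun t => 4 * μ * (Real.exp t + h t), ?_, ?_, ?_, ?_⟩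
  · -- the front equation, rescaled
    intro t ht
    have h1 := (hfront t ht).const_mul (4 * μ)
    refine h1.congr_deriv ?_
    rw [hΛ, ← hμsq]
    field_simp
  · -- integrability on `(−∞, 0)`
    have hC : 0 ≤ (8800000 : ℝ) * (2 - s) := by rw [← hη]; positivity
    have hexp : IntegrableOn (fun t : ℝ => Real.exp t) (Iio 0) :=
      (integrableOn_exp_Iic 0).mono_set Iio_subset_Iic_self
    have hg : IntegrableOn (fun t : ℝ => 8800000 * (2 - s) * Real.exp (1 / 2 * t)) (Iio 0) :=
      ((integrableOn_exp_mul_Iic (by norm_num : (0 : ℝ) < 1 / 2) 0).mono_set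
        Iio_subset_Iic_self).const_mul _
    have hh : IntegrableOn h (Iio 0) := by
      refine Integrable.mono' hg ?_ ?_
      · exact (hcont.mono Iio_subset_Iic_self).aestronglyMeasurable measurableSet_Iio
      · refine (ae_restrict_iff' measurableSet_Iio).2 (Eventually.of_forall fun t ht => ?_)
        rw [Real.norm_eq_abs, show (1 : ℝ) / 2 * t = t / 2 by ring]
        exact hhρ t (le_of_lt ht)
    exact (hexp.add hh).const_mul _
  · -- bounded near `0⁻`
    refine ⟨-1, by norm_num, 4 * μ * (1 + 8800000 * (2 - s)), fun t _ ht => ?_⟩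
    have he : Real.exp t ≤ 1 := Real.exp_le_one_iff.2 ht.le
    have hht : |h t| ≤ 8800000 * (2 - s) := (hhρ t ht.le).trans (by
      have : Real.exp (t / 2) ≤ 1 := Real.exp_le_one_iff.2 (by linarith)
      have : 0 ≤ (8800000 : ℝ) * (2 - s) := by rw [← hη]; positivity
      nlinarith)
    rw [abs_mul, abs_of_pos (by positivity : (0 : ℝ) < 4 * μ)]
    refine mul_le_mul_of_nonneg_left ?_ (by positivity)
    calc |Real.exp t + h t| ≤ |Real.exp t| + |h t| := abs_add_le _ _
      _ ≤ 1 + 8800000 * (2 - s) := by rw [abs_of_pos (Real.exp_pos t)]; linarith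
  · -- non-zero at `t = −1`
    refine ⟨-1, by norm_num, ?_⟩
    have hh1 : |h (-1)| ≤ 8800000 * (2 - s) * Real.exp (-1 / 2) := hhρ (-1) (by norm_num)
    have hsmall : 8800000 * (2 - s) * Real.exp (-1 / 2) ≤ 1 / 10 := by
      have : Real.exp (-1 / 2 : ℝ) ≤ 1 := Real.exp_le_one_iff.2 (by norm_num)
      have : (8800000 : ℝ) * (2 - s) ≤ 1 / 10 := by rw [← hη]; nlinarith
      have : 0 ≤ (8800000 : ℝ) * (2 - s) := by rw [← hη]; positivity
      nlinarith
    have he : 1 / 3 < Real.exp (-1 : ℝ) := by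
      rw [Real.exp_neg, lt_inv_comm₀ (by norm_num) (Real.exp_pos 1)]
      have := Real.exp_one_lt_d9; norm_num at this ⊢; linarith
    have hpos : 0 < Real.exp (-1) + h (-1) := by
      have := (abs_le.1 hh1).1; linarith
    exact mul_ne_zero (by positivity) hpos.ne'

/-- **A NON-TRIVIAL ADMISSIBLE DSS BLOW-UP WAVE OF THE DYADIC MEMBER EXISTS** at some (large) scale
parameter `ε₀ > 0`: single profile (`q = 1`, `π = 1`), delay `T = log s`.
[cite: Tao2016AveragedNS, §1.2 (dyadic model), §4 Lemma 4.1 (4.8) in the self-similar variables of §6.4; cell vocabulary (`IsDSSWave`, `dyadicTable`; tree dictionary `isDSSWave_dyadic_of_scalarFront`)] -/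
theorem lacunary_dssWave :
    ∃ ε₀ : ℝ, 0 < ε₀ ∧ ∃ (T : ℝ) (Φ : Fin 1 → ℝ → Em 4),
      IsDSSWave ε₀ dyadicTable (1 : Equiv.Perm (Fin 1)) T Φ ∧ ∃ r x, Φ r x ≠ 0 := by
  obtain ⟨η₀, hη₀, H⟩ := lacunary_scalar_front
  have hs : 2 - η₀ ≤ 2 - min η₀ 1 / 2 := by
    have := min_le_left η₀ 1; linarith
  have hs2 : 2 - min η₀ 1 / 2 < 2 := by
    have : 0 < min η₀ 1 := lt_min hη₀ one_pos; linarith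
  have hs1 : 1 < 2 - min η₀ 1 / 2 := by
    have := min_le_right η₀ 1; linarith
  obtain ⟨ε₀, hε₀, a, hode, hint, hbdd, t₁, ht₁, hne⟩ := H _ hs hs2
  refine ⟨ε₀, hε₀, _, _, isDSSWave_dyadic_of_scalarFront hε₀ hs1 hode hint hbdd, 0, -Real.log (-t₁), ?_⟩
  have ht : -Real.exp (-(-Real.log (-t₁))) = t₁ := by
    rw [neg_neg, Real.exp_log (neg_pos.2 ht₁), neg_neg]
  rw [ht]
  intro h0
  rw [smul_eq_zero] at h0
  rcases h0 with h0 | h0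
  · exact (mul_ne_zero (Real.exp_pos _).ne' hne) h0
  · exact one_ne_zero ((PiLp.single_eq_zero_iff 2 (0 : Fin 4)).1 h0)

/-- **THE HYPOTHESIS CLASS OF THE K1-FAMILY IS NON-EMPTY**: at some (large) scale parameter `ε₀ > 0` the
dyadic member `dyadicTable ∈ E₂(2)` carries a NON-ZERO admissible eternal solution obeying the uniform
(type-I) bound — the eternal solution carried by the lacunary DSS front.
[cite: Tao2016AveragedNS, §1.2 (dyadic model), §4 Lemma 4.1 (4.8), §6.4; cell vocabulary (`IsEternal`, `UniformBound`, `dssEmbed`)] -/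
theorem nontrivial_bounded_eternal :
    ∃ ε₀ : ℝ, 0 < ε₀ ∧ ∃ W : ℤ → ℝ → Em 4,
      IsEternal ε₀ dyadicTable W ∧ UniformBound W ∧ InTableClass 2 dyadicTable ∧ ∃ n σ, W n σ ≠ 0 := by
  obtain ⟨ε₀, hε₀, T, Φ, hW, r, x, hne⟩ := lacunary_dssWave
  refine ⟨ε₀, hε₀, dssEmbed (1 : Equiv.Perm (Fin 1)) T Φ r, hW.isEternal_dssEmbed r,
    uniformBound_dssEmbed hW r, inTableClass_dyadicTable le_rfl, 0, x, ?_⟩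
  simpa [dssEmbed] using hne

/-! ## Appendix (appended): the base `Λ` of the lacunary fronts is as large as desired -/

/-- **EXACT SCALAR DYADIC FRONTS AT ARBITRARILY LARGE LATTICE RATIO** (quantitative form of "lacunary"):
for every `Λ₀ ≥ 1` there is `η₀ > 0` such that for every time ratio `s ∈ [2 − η₀, 2)` the four clauses of
`WakeRatchetDyadicFront.DyadicScalarFronts` hold at a scale parameter `ε₀ > 0` with base
`Λ = bigLam ε₀ ≥ Λ₀` (indeed `Λ = δ_s^{-1/2} ≥ (8Kη)^{-1/2}`, `η = 2 − s`).  So exact DSS blow-up fronts of the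
inviscid dyadic chain exist along a sequence of bases `Λ → ∞` — the end OPPOSITE to the one (`Λ → 1⁺`) that
`DyadicScalarFronts` / the refutation of `TailRatchet` require.
[cite: Tao2016AveragedNS, §1.2 (dyadic Katz–Pavlović model); cell vocabulary (`DyadicScalarFronts`, `bigLam`; programme R-lac of the census of stmt-21808)] -/
theorem lacunary_scalar_front_base (Λ₀ : ℝ) (hΛ₀ : 1 ≤ Λ₀) :
    ∃ η₀ : ℝ, 0 < η₀ ∧ ∀ s : ℝ, 2 - η₀ ≤ s → s < 2 →
      ∃ ε₀ : ℝ, 0 < ε₀ ∧ Λ₀ ≤ bigLam ε₀ ∧ ∃ a : ℝ → ℝ,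
        (∀ t : ℝ, t < 0 → HasDerivAt a
          (bigLam ε₀ / s ^ 2 * a (t / s) ^ 2 - s / bigLam ε₀ * a t * a (s * t)) t) ∧
        IntegrableOn a (Iio 0) ∧
        (∃ t₀ : ℝ, t₀ < 0 ∧ ∃ P : ℝ, ∀ t : ℝ, t₀ ≤ t → t < 0 → |a t| ≤ P) ∧
        ∃ t : ℝ, t < 0 ∧ a t ≠ 0 := by
  obtain ⟨η₁, hη₁, hresp⟩ := linear_response_lower
  have hΛ₀pos : 0 < Λ₀ := by linarith
  refine ⟨min (min η₁ (1 / (2 * 10 ^ 26))) (1 / (8800000 * Λ₀ ^ 2)), lt_min (lt_min hη₁ (by norm_num))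
    (by positivity), fun s hsl hsu => ?_⟩
  have hm1 : min (min η₁ (1 / (2 * 10 ^ 26))) (1 / (8800000 * Λ₀ ^ 2)) ≤ η₁ :=
    (min_le_left _ _).trans (min_le_left _ _)
  have hm2 : min (min η₁ (1 / (2 * 10 ^ 26))) (1 / (8800000 * Λ₀ ^ 2)) ≤ 1 / (2 * 10 ^ 26) :=
    (min_le_left _ _).trans (min_le_right _ _)
  have hm3 : min (min η₁ (1 / (2 * 10 ^ 26))) (1 / (8800000 * Λ₀ ^ 2)) ≤ 1 / (8800000 * Λ₀ ^ 2) :=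
    min_le_right _ _
  set η : ℝ := 2 - s with hη
  have hηpos : 0 < η := by rw [hη]; linarith
  have hη1 : η ≤ 1 / (2 * 10 ^ 26) := by rw [hη]; linarith
  have hη3 : η ≤ 1 / (8800000 * Λ₀ ^ 2) := by rw [hη]; linarith
  have hs1 : 2 - 1 / 10 ^ 26 ≤ s := by
    have : (1 : ℝ) / (2 * 10 ^ 26) ≤ 1 / 10 ^ 26 := by norm_num
    linarith
  have hs0 : 0 < s := by
    have : (1 : ℝ) / (2 * 10 ^ 26) ≤ 1 := by norm_num
    linarith
  -- the lacunary front and the sign of its drain parameter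
  obtain ⟨δ, h, hcont, hh0, hhρ, hδle, hfront, hsecond⟩ := relay_front_exists hs1 hsu.le
  have hε₁ := hresp s (by linarith) hsu.le
  have hδpos : 0 < δ := by
    have h1 := (abs_le.1 hsecond).1
    rw [← hη] at h1 hε₁
    have h2 : (10 : ℝ) ^ 22 * η ^ 2 ≤ η / 20000 := by
      rw [show (10 : ℝ) ^ 22 * η ^ 2 = (10 ^ 22 * η) * η by ring, div_eq_mul_inv, mul_comm η]
      exact mul_le_mul_of_nonneg_right (by nlinarith) hηpos.le
    nlinarith
  -- `δ ≤ 8Kη ≤ 1/Λ₀²`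
  have hδΛ : δ ≤ 1 / Λ₀ ^ 2 := by
    have h1 := (abs_le.1 hδle).2
    rw [← hη] at h1
    have h2 : (8800000 : ℝ) * η ≤ 1 / Λ₀ ^ 2 := by
      have := mul_le_mul_of_nonneg_left hη3 (by norm_num : (0 : ℝ) ≤ 8800000)
      rw [show (8800000 : ℝ) * (1 / (8800000 * Λ₀ ^ 2)) = 1 / Λ₀ ^ 2 by field_simp] at this
      exact this
    linarith
  have hδlt : δ < 1 := by
    have : (8800000 : ℝ) * (2 - s) < 1 := by rw [← hη]; nlinarith
    linarith [(abs_le.1 hδle).2]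
  -- `μ = δ^{1/2}`, `Λ = 1/μ ≥ Λ₀`, `ε₀ = Λ^{2/5} − 1`
  set μ : ℝ := Real.sqrt δ with hμ
  have hμpos : 0 < μ := Real.sqrt_pos.2 hδpos
  have hμsq : μ ^ 2 = δ := Real.sq_sqrt hδpos.le
  have hμlt : μ < 1 := by
    rw [hμ]
    calc Real.sqrt δ < Real.sqrt 1 := Real.sqrt_lt_sqrt hδpos.le hδlt
      _ = 1 := Real.sqrt_one
  have hμΛ : μ ≤ 1 / Λ₀ := by
    rw [hμ]
    calc Real.sqrt δ ≤ Real.sqrt (1 / Λ₀ ^ 2) := Real.sqrt_le_sqrt hδΛ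
      _ = 1 / Λ₀ := by
        rw [show (1 : ℝ) / Λ₀ ^ 2 = (1 / Λ₀) ^ 2 by ring, Real.sqrt_sq (by positivity)]
  set ε₀ : ℝ := (1 / μ) ^ ((2 : ℝ) / 5) - 1 with hε₀
  have hinv : 1 < 1 / μ := by rw [lt_div_iff₀ hμpos]; linarith
  have hε₀pos : 0 < ε₀ := by
    rw [hε₀, sub_pos]
    exact Real.one_lt_rpow hinv (by norm_num)
  have hΛ : bigLam ε₀ = 1 / μ := by
    unfold bigLam
    rw [hε₀, add_sub_cancel, ← Real.rpow_mul (by positivity)]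
    norm_num
  have hΛge : Λ₀ ≤ bigLam ε₀ := by
    rw [hΛ]; exact (le_one_div hΛ₀pos hμpos).2 hμΛ
  refine ⟨ε₀, hε₀pos, hΛge, fun t => 4 * μ * (Real.exp t + h t), ?_, ?_, ?_, ?_⟩
  · -- the front equation, rescaled
    intro t ht
    have h1 := (hfront t ht).const_mul (4 * μ)
    refine h1.congr_deriv ?_
    rw [hΛ, ← hμsq]
    field_simp
  · -- integrability on `(−∞, 0)`
    have hexp : IntegrableOn (fun t : ℝ => Real.exp t) (Iio 0) :=
      (integrableOn_exp_Iic 0).mono_set Iio_subset_Iic_self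
    have hg : IntegrableOn (fun t : ℝ => 8800000 * (2 - s) * Real.exp (1 / 2 * t)) (Iio 0) :=
      ((integrableOn_exp_mul_Iic (by norm_num : (0 : ℝ) < 1 / 2) 0).mono_set
        Iio_subset_Iic_self).const_mul _
    have hh : IntegrableOn h (Iio 0) := by
      refine Integrable.mono' hg ?_ ?_
      · exact (hcont.mono Iio_subset_Iic_self).aestronglyMeasurable measurableSet_Iio
      · refine (ae_restrict_iff' measurableSet_Iio).2 (Eventually.of_forall fun t ht => ?_)
        rw [Real.norm_eq_abs, show (1 : ℝ) / 2 * t = t / 2 by ring]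
        exact hhρ t (le_of_lt ht)
    exact (hexp.add hh).const_mul _
  · -- bounded near `0⁻`
    refine ⟨-1, by norm_num, 4 * μ * (1 + 8800000 * (2 - s)), fun t _ ht => ?_⟩
    have he : Real.exp t ≤ 1 := Real.exp_le_one_iff.2 ht.le
    have hht : |h t| ≤ 8800000 * (2 - s) := (hhρ t ht.le).trans (by
      have : Real.exp (t / 2) ≤ 1 := Real.exp_le_one_iff.2 (by linarith)
      have : 0 ≤ (8800000 : ℝ) * (2 - s) := by rw [← hη]; positivity
      nlinarith)
    rw [abs_mul, abs_of_pos (by positivity : (0 : ℝ) < 4 * μ)]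
    refine mul_le_mul_of_nonneg_left ?_ (by positivity)
    calc |Real.exp t + h t| ≤ |Real.exp t| + |h t| := abs_add_le _ _
      _ ≤ 1 + 8800000 * (2 - s) := by rw [abs_of_pos (Real.exp_pos t)]; linarith
  · -- non-zero at `t = −1`
    refine ⟨-1, by norm_num, ?_⟩
    have hh1 : |h (-1)| ≤ 8800000 * (2 - s) * Real.exp (-1 / 2) := hhρ (-1) (by norm_num)
    have hsmall : 8800000 * (2 - s) * Real.exp (-1 / 2) ≤ 1 / 10 := by
      have : Real.exp (-1 / 2 : ℝ) ≤ 1 := Real.exp_le_one_iff.2 (by norm_num)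
      have : (8800000 : ℝ) * (2 - s) ≤ 1 / 10 := by rw [← hη]; nlinarith
      have : 0 ≤ (8800000 : ℝ) * (2 - s) := by rw [← hη]; positivity
      nlinarith
    have he : 1 / 3 < Real.exp (-1 : ℝ) := by
      rw [Real.exp_neg, lt_inv_comm₀ (by norm_num) (Real.exp_pos 1)]
      have := Real.exp_one_lt_d9; norm_num at this ⊢; linarith
    have hpos : 0 < Real.exp (-1) + h (-1) := by
      have := (abs_le.1 hh1).1; linarith
    exact mul_ne_zero (by positivity) hpos.ne'

/-! ## Appendix (appended): the construction item's matrix at the LARGE-`ε₀` end -/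

/-- **`DyadicScalarFronts` AT THE LARGE-`ε₀` END.**  The construction item
`WakeRatchetDyadicFront.DyadicScalarFronts` asks, for every `ε > 0`, for a scale parameter `ε₀ ≤ ε` carrying an
exact scalar dyadic DSS front.  The MIRROR statement holds: for every `E > 0` there is a scale parameter
`ε₀ ≥ E` carrying one (same four clauses, verbatim) — exact DSS blow-up fronts of the inviscid dyadic chain
exist at arbitrarily LARGE scale ratio `1 + ε₀`.  (The small-`ε₀` end, which alone refutes `TailRatchet`,
remains open.)
[cite: Tao2016AveragedNS, §1.2 (dyadic Katz–Pavlović model); cell vocabulary (`DyadicScalarFronts`, `bigLam`; programme R-lac of the census of stmt-21808)] -/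
theorem dyadicScalarFronts_large :
    ∀ E : ℝ, 0 < E → ∃ ε₀ : ℝ, 0 < ε₀ ∧ E ≤ ε₀ ∧ ∃ s : ℝ, 1 < s ∧ ∃ a : ℝ → ℝ,
      (∀ t : ℝ, t < 0 → HasDerivAt a
        (bigLam ε₀ / s ^ 2 * a (t / s) ^ 2 - s / bigLam ε₀ * a t * a (s * t)) t) ∧
      IntegrableOn a (Iio 0) ∧
      (∃ t₀ : ℝ, t₀ < 0 ∧ ∃ P : ℝ, ∀ t : ℝ, t₀ ≤ t → t < 0 → |a t| ≤ P) ∧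
      ∃ t : ℝ, t < 0 ∧ a t ≠ 0 := by
  intro E hE
  -- base `Λ₀ = (1+E)^{5/2} ≥ 1`
  have hΛ₀ : 1 ≤ (1 + E) ^ ((5 : ℝ) / 2) := Real.one_le_rpow (by linarith) (by norm_num)
  obtain ⟨η₀, hη₀, H⟩ := lacunary_scalar_front_base ((1 + E) ^ ((5 : ℝ) / 2)) hΛ₀
  -- a time ratio in `[2 − η₀, 2)`
  have hs : 2 - η₀ ≤ 2 - min η₀ 1 / 2 := by
    have := min_le_left η₀ 1; linarith
  have hs2 : 2 - min η₀ 1 / 2 < 2 := by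
    have : 0 < min η₀ 1 := lt_min hη₀ one_pos; linarith
  have hs1 : 1 < 2 - min η₀ 1 / 2 := by
    have := min_le_right η₀ 1; linarith
  obtain ⟨ε₀, hε₀, hΛ, a, hode, hint, hbdd, hne⟩ := H _ hs hs2
  refine ⟨ε₀, hε₀, ?_, _, hs1, a, hode, hint, hbdd, hne⟩
  -- `(1+E)^{5/2} ≤ (1+ε₀)^{5/2}` ⇒ `E ≤ ε₀`
  have h := (Real.rpow_le_rpow_iff (by linarith) (by linarith) (by norm_num : (0 : ℝ) < 5 / 2)).1
    (show (1 + E) ^ ((5 : ℝ) / 2) ≤ (1 + ε₀) ^ ((5 : ℝ) / 2) from hΛ)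
  linarith

end WakeRatchetLacunaryFront

end Summit.NavierStokesRegularity.NavierStokesRegularity.Theorems

end
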